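/-
Copyright (c) 2026 the pub-hodgecm-mathlib formalisation cell (harness21).  Prover seat hodgecm-mathlib-F0P2-p01 (g15): road «S3-ram» (LEAD F0P3a-plan (g12); architect
A-p16 (g31); owner F0P3a-p06 (g15)), organ A′ (ii): the regime fact `hodd` («rank 1 only at ODD depth») of the (a2)(B) tree-induction engine ★ p847302 (J-PACK J5,
F0P3a-p01 (g16) 23:57:42Z); 2026-09-02.
-/
import Literature.NumberTheory.Automorphic.UnitaryLatticeTreeFixedChildTokensRamified   -- ★ p847340 (this seat): `map_toLin'_latt_le_scaleLattice_iff`, `inv_mul_sq_mul_eq_sq`; brings ★ G `v_coe_sub_one_apply_add_sigma_rev_le`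
import HarnessLib

/-!
# The lattice graph of a hermitian space — AT EVEN DEPTH A DEEP UNITARY ELEMENT HAS RESIDUAL RANK 2 (tame-ramified place): the residual matrix is `J₀`-alternating,
# so it is zero or of square `≠ 0` (Bruhat–Tits 1972 §10; Tits 1979 §3.5; Kottwitz 1986 §3)

Topic `NumberTheory/Automorphic`; namespace `Literature.NumberTheory.Automorphic.UnitaryLatticeTree`.  THEOREMS ONLY (no definition, no instance, no notation, no named fact,
no `sorry`); kernel lane `--supports stmt-HodgeConjecture-24833`.  Cell `pub/hodgecm-mathlib` (D-0151), crux H413; road «S3-ram» (Literature seeding, count-neutral), organ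
A′ (ii) of the P-1-ram skeleton (architect A-p16 (g31)).  The tree-induction engine ★ p847302 (F0P3a-p01 (g16)) carries the regime hypothesis
`hodd : 2 ≤ dep v → rk v = 1 → Odd (dep v)` — rank-1 labels `P^±_m` live at ODD depth only (CERT smoke v1.3 §6: labels `(2m+1, 1, ±)`; the law table's parity lemma
«`J̄₀Ȳ` symmetric for odd `d`, ALTERNATING for even `d`», F0P3a-p01 22:51:51Z).  THIS FILE proves its contrapositive at the valuation level (J₀-model, DATUM: `σ`
valuation-preserving with `σϖ = −ϖ`, residually trivial, residue characteristic `≠ 2`): for `γ ∈ U(σ, J₀)` with `Y := γ − 1` of level `ϖ^d`, `d` EVEN, `d ≥ 1`, **if `Y²` has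
level `ϖ^{2d+1}` then `Y` has level `ϖ^{d+1}`** — a non-zero alternating residual matrix has rank `2`, hence non-zero square.

THE MATHEMATICS.  ★ G's first-order skew-hermitian law gives `Y_{ij} + σ(Y_{rev j, rev i}) ≡ 0 (ϖ^{2d})`; for `|y| ≤ |ϖ|^d` with `d` even, `σ(y) ≡ y (ϖ^{d+1})` (`y = ϖ^d u`,
`σ(ϖ^d) = (−ϖ)^d = ϖ^d`, `σu ≡ u`), so **`Y_{ij} + Y_{rev j, rev i} ≡ 0 (ϖ^{d+1})`** (`v_coe_sub_one_apply_add_rev_le_of_even`): the residual `S = J̄₀Ȳ` is antisymmetric, with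
zero diagonal `Y_{rev i, i} ≡ 0` as `2` is a residual unit (`v_coe_sub_one_rev_apply_le_of_even`).  Writing `Ȳ = !![−β, −γ, 0; −α, 0, γ; 0, α, β]` one has
`(Ȳ²)₂₀ = −α²`, `(Ȳ²)₀₂ = −γ²`, `(Ȳ²)₀₀ = β² + αγ`; so `Ȳ² = 0` forces `α = γ = 0`, then `β = 0`, i.e. `Ȳ = 0`.  In valuations: `|(Y²)_{ij}| ≤ |ϖ|^{2d+1}` for all `i, j` forces
`|Y₂₁|, |Y₁₂| ≤ |ϖ|^{d+1}` (corner squares), then `|Y₀₀| ≤ |ϖ|^{d+1}`, then every entry (`forall_v_coe_sub_one_le_succ_of_even_of_sq_le`).  LATTICE READING at a self-dual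
vertex `u·L₀` (`u` unitary; tokens of sheet d81ac9e9): **`LEV (ϖ^d) ∧ LEV₂ (ϖ^{2d+1}) ∧ Even d ∧ 1 ≤ d ⇒ LEV (ϖ^{d+1})`** (`map_sub_one_latt_le_scaleLattice_succ_of_even`) —
equivalently «depth exactly `d` even ⇒ rank 2» = `hodd`.

* §1 `v_sigma_sub_self_le_of_even` (`σy ≡ y (ϖ^{d+1})` for `|y| ≤ |ϖ|^d`, `d` even), **`v_coe_sub_one_apply_add_rev_le_of_even`** (antisymmetry), `v_coe_sub_one_rev_apply_le_of_even`
  (zero diagonal), `v_le_succ_of_sq_le` (discreteness: `|y| ≤ |ϖ|^d`, `|y²| ≤ |ϖ|^{2d+1}` ⇒ `|y| ≤ |ϖ|^{d+1}`).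
* §2 **`forall_v_coe_sub_one_le_succ_of_even_of_sq_le`** (matrix form), **`map_sub_one_latt_le_scaleLattice_succ_of_even`** (token form at `u·L₀`).

HONEST LABEL: HC_CM is proved only modulo the 2 remaining named inputs (hLiu418 24832, h413 24833) until rung 0 closes; nothing printed is asserted here (elementary algebra
over a valuation ring); «S3-ram» has no books consequence.

## References
* [BruhatTits1972] F. Bruhat, J. Tits, *Groupes réductifs sur un corps local I*, Publ. Math. IHÉS 41 (1972), §10 (vertex stabilisers and their congruence filtrations).
* [Tits1979] J. Tits, *Reductive groups over local fields*, PSPM 33.1 (1979), §3.5 (the filtration quotients of a parahoric; ramified unitary groups).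
* [Kottwitz1986] R. E. Kottwitz, *Base change for unit elements of Hecke algebras*, Compositio Math. 60 (1986), §3 (levels of fixed lattices).
* [Serre1980Trees] J.-P. Serre, *Trees* (1980), Ch. II §1.1–1.2 (lattices and levels).
-/

set_option autoImplicit false

noncomputable section

open scoped Valued WithZero Matrix MatrixGroups

namespace Literature.NumberTheory.Automorphic.UnitaryLatticeTree

open Literature.NumberTheory.Automorphic Literature.NumberTheory.Automorphic.HermitianLattice

variable {K : Type*} [Field K] [Valued K ℤᵐ⁰] {σ : K →+* K} {ϖ : K}

/-! ## §1 Antisymmetry of the residual matrix at even depth -/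

/-- **`σ(y) ≡ y (mod ϖ^{d+1})` for `|y| ≤ |ϖ|^d`, `d` even** (`σϖ = −ϖ`, `σ` valuation-preserving and residually trivial): `y = ϖ^d·u`, `σ(ϖ^d) = (−ϖ)^d = ϖ^d`, `|σu − u| < 1`.
[cite: Tits1979, §3.5] [cite: BruhatTits1972, §10] -/
theorem v_sigma_sub_self_le_of_even (hσϖ : σ ϖ = -ϖ) (hϖ : Valued.v ϖ = WithZero.exp (-1 : ℤ))
    (hres : ∀ x : K, Valued.v x ≤ 1 → Valued.v (σ x - x) < 1) {d : ℕ} (hd : Even d) {y : K} (hy : Valued.v y ≤ Valued.v ϖ ^ d) :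
    Valued.v (σ y - y) ≤ Valued.v ϖ ^ (d + 1) := by
  have hϖ0 : ϖ ≠ 0 := fun h0 => by rw [h0, map_zero] at hϖ; exact WithZero.coe_ne_zero hϖ.symm
  have hvϖ0 : Valued.v ϖ ≠ 0 := (Valuation.ne_zero_iff _).2 hϖ0
  have hpd : (ϖ ^ d : K) ≠ 0 := pow_ne_zero _ hϖ0
  -- `u := (ϖ^d)⁻¹ y` is integral
  have hu : Valued.v ((ϖ ^ d)⁻¹ * y) ≤ 1 := by
    rw [map_mul, map_inv₀, map_pow]
    calc (Valued.v ϖ ^ d)⁻¹ * Valued.v y ≤ (Valued.v ϖ ^ d)⁻¹ * Valued.v ϖ ^ d := mul_le_mul' le_rfl hy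
      _ = 1 := inv_mul_cancel₀ (pow_ne_zero _ hvϖ0)
  have hσpow : σ (ϖ ^ d) = ϖ ^ d := by rw [map_pow, hσϖ, hd.neg_pow]
  have e : σ y - y = ϖ ^ d * (σ ((ϖ ^ d)⁻¹ * y) - (ϖ ^ d)⁻¹ * y) := by
    rw [map_mul, map_inv₀, hσpow]; field_simp
  rw [e, map_mul, map_pow, pow_succ]
  refine mul_le_mul' le_rfl ?_
  -- discreteness: `< 1 = |ϖ|·exp 1` means `≤ |ϖ|`
  have hlt := hres _ hu
  have h1 : (1 : ℤᵐ⁰) = Valued.v ϖ * WithZero.exp (1 : ℤ) := by rw [hϖ, ← WithZero.exp_add]; norm_num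
  rw [h1] at hlt
  exact (WithZero.lt_mul_exp_iff_le hvϖ0).1 hlt

/-- **ANTISYMMETRY AT EVEN DEPTH**: for `γ ∈ U(σ, J₀)` with `Y = γ − 1` of level `ϖ^d`, `d` even, `d ≥ 1`: `|Y_{ij} + Y_{rev j, rev i}| ≤ |ϖ|^{d+1}` — the residual `J̄₀Ȳ` is
alternating (the parity lemma of the (a2) law table at even `d`). [cite: Tits1979, §3.5] [cite: BruhatTits1972, §10] -/
theorem v_coe_sub_one_apply_add_rev_le_of_even (hvσ : ∀ z, Valued.v (σ z) = Valued.v z) (hσϖ : σ ϖ = -ϖ) (hϖ : Valued.v ϖ = WithZero.exp (-1 : ℤ))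
    (hres : ∀ x : K, Valued.v x ≤ 1 → Valued.v (σ x - x) < 1)
    (γ : unitaryGroupOfForm σ ((StdForm.antidiagonal 3).over K)) {d : ℕ} (hd : Even d) (hd1 : 1 ≤ d)
    (hY : ∀ i j, Valued.v ((((γ : GL (Fin 3) K) : Matrix (Fin 3) (Fin 3) K) - 1) i j) ≤ Valued.v ϖ ^ d) (i j : Fin 3) :
    Valued.v ((((γ : GL (Fin 3) K) : Matrix (Fin 3) (Fin 3) K) - 1) i j + (((γ : GL (Fin 3) K) : Matrix (Fin 3) (Fin 3) K) - 1) j.rev i.rev) ≤ Valued.v ϖ ^ (d + 1) := by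
  set Y : Matrix (Fin 3) (Fin 3) K := ((γ : GL (Fin 3) K) : Matrix (Fin 3) (Fin 3) K) - 1 with hYdef
  have hϖ0 : ϖ ≠ 0 := fun h0 => by rw [h0, map_zero] at hϖ; exact WithZero.coe_ne_zero hϖ.symm
  have hϖ1 : Valued.v ϖ ≤ 1 := by rw [hϖ, ← WithZero.exp_zero]; exact WithZero.exp_le_exp.2 (by norm_num)
  have hskew := v_coe_sub_one_apply_add_sigma_rev_le hvσ γ hY i j
  have hσ := v_sigma_sub_self_le_of_even hσϖ hϖ hres hd (hY j.rev i.rev)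
  have h2d : Valued.v ϖ ^ d * Valued.v ϖ ^ d ≤ Valued.v ϖ ^ (d + 1) := by
    rw [← pow_add]; exact pow_le_pow_right_of_le_one' hϖ1 (by omega)
  have e : Y i j + Y j.rev i.rev = (Y i j + σ (Y j.rev i.rev)) - (σ (Y j.rev i.rev) - Y j.rev i.rev) := by ring
  rw [e]
  exact (Valuation.map_sub _ _ _).trans (max_le (hskew.trans h2d) hσ)

/-- **ZERO DIAGONAL of the alternating residual form**: `|Y_{rev i, i}| ≤ |ϖ|^{d+1}` (residue characteristic `≠ 2`: `2Y_{rev i,i} ≡ 0`).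
[cite: Tits1979, §3.5] [cite: BruhatTits1972, §10] -/
theorem v_coe_sub_one_rev_apply_le_of_even (hvσ : ∀ z, Valued.v (σ z) = Valued.v z) (hσϖ : σ ϖ = -ϖ) (hϖ : Valued.v ϖ = WithZero.exp (-1 : ℤ))
    (hres : ∀ x : K, Valued.v x ≤ 1 → Valued.v (σ x - x) < 1) (h2 : Valued.v (2 : K) = 1)
    (γ : unitaryGroupOfForm σ ((StdForm.antidiagonal 3).over K)) {d : ℕ} (hd : Even d) (hd1 : 1 ≤ d)
    (hY : ∀ i j, Valued.v ((((γ : GL (Fin 3) K) : Matrix (Fin 3) (Fin 3) K) - 1) i j) ≤ Valued.v ϖ ^ d) (i : Fin 3) :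
    Valued.v ((((γ : GL (Fin 3) K) : Matrix (Fin 3) (Fin 3) K) - 1) i.rev i) ≤ Valued.v ϖ ^ (d + 1) := by
  have h := v_coe_sub_one_apply_add_rev_le_of_even hvσ hσϖ hϖ hres γ hd hd1 hY i.rev i
  rw [Fin.rev_rev, ← two_mul, map_mul, h2, one_mul] at h
  exact h

/-- **Discreteness step**: `|y| ≤ |ϖ|^d` and `|y·y| ≤ |ϖ|^{2d+1}` force `|y| ≤ |ϖ|^{d+1}`. [cite: Serre1980Trees, II.1.1] -/
theorem v_le_succ_of_sq_le (hϖ : Valued.v ϖ = WithZero.exp (-1 : ℤ)) {d : ℕ} {y : K} (hy : Valued.v y ≤ Valued.v ϖ ^ d)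
    (hsq : Valued.v (y * y) ≤ Valued.v ϖ ^ (2 * d + 1)) : Valued.v y ≤ Valued.v ϖ ^ (d + 1) := by
  have hϖ0 : ϖ ≠ 0 := fun h0 => by rw [h0, map_zero] at hϖ; exact WithZero.coe_ne_zero hϖ.symm
  have hvϖ0 : Valued.v ϖ ≠ 0 := (Valuation.ne_zero_iff _).2 hϖ0
  have hϖlt : Valued.v ϖ < 1 := by rw [hϖ, ← WithZero.exp_zero]; exact WithZero.exp_lt_exp.2 (by norm_num)
  by_contra hne
  -- then `|y| = |ϖ|^d` (discreteness) and `|y²| = |ϖ|^(2d) > |ϖ|^(2d+1)`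
  have hge : Valued.v ϖ ^ d ≤ Valued.v y := by
    by_contra hlt
    rw [not_le] at hlt
    have hdm : Valued.v ϖ ^ d = Valued.v ϖ ^ (d + 1) * WithZero.exp (1 : ℤ) := by
      rw [pow_succ, hϖ, mul_assoc, ← WithZero.exp_add]; norm_num
    rw [hdm] at hlt
    exact hne ((WithZero.lt_mul_exp_iff_le (pow_ne_zero _ hvϖ0)).1 hlt)
  have heq : Valued.v y = Valued.v ϖ ^ d := le_antisymm hy hge
  have h2d : Valued.v ϖ ^ (2 * d + 1) < Valued.v ϖ ^ d * Valued.v ϖ ^ d := by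
    rw [← pow_add, show d + d = 2 * d by ring, pow_succ]
    exact mul_lt_of_lt_one_right (zero_lt_iff.2 (pow_ne_zero _ hvϖ0)) hϖlt
  rw [map_mul, heq] at hsq
  exact (lt_irrefl _) (hsq.trans_lt h2d)

/-! ## §2 Even depth and square of deeper level force deeper level -/

/-- **AT EVEN DEPTH, RANK `≤ 1` FORCES DEPTH `+1`** (matrix form): for `γ ∈ U(σ, J₀)`, `Y = γ − 1` with `|Y_{ij}| ≤ |ϖ|^d` (`d` even, `d ≥ 1`) and `|(Y²)_{ij}| ≤ |ϖ|^{2d+1}`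
for all `i, j`: `|Y_{ij}| ≤ |ϖ|^{d+1}` for all `i, j` — a non-zero alternating residual matrix has non-zero square.  Contrapositive = the engine's `hodd`.
[cite: Tits1979, §3.5] [cite: Kottwitz1986, §3] [cite: BruhatTits1972, §10] -/
theorem forall_v_coe_sub_one_le_succ_of_even_of_sq_le (hvσ : ∀ z, Valued.v (σ z) = Valued.v z) (hσϖ : σ ϖ = -ϖ) (hϖ : Valued.v ϖ = WithZero.exp (-1 : ℤ))
    (hres : ∀ x : K, Valued.v x ≤ 1 → Valued.v (σ x - x) < 1) (h2 : Valued.v (2 : K) = 1)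
    (γ : unitaryGroupOfForm σ ((StdForm.antidiagonal 3).over K)) {d : ℕ} (hd : Even d) (hd1 : 1 ≤ d)
    (hY : ∀ i j, Valued.v ((((γ : GL (Fin 3) K) : Matrix (Fin 3) (Fin 3) K) - 1) i j) ≤ Valued.v ϖ ^ d)
    (hsq : ∀ i j, Valued.v (((((γ : GL (Fin 3) K) : Matrix (Fin 3) (Fin 3) K) - 1) * ((((γ : GL (Fin 3) K) : Matrix (Fin 3) (Fin 3) K) - 1))) i j) ≤ Valued.v ϖ ^ (2 * d + 1))
    (i j : Fin 3) :
    Valued.v ((((γ : GL (Fin 3) K) : Matrix (Fin 3) (Fin 3) K) - 1) i j) ≤ Valued.v ϖ ^ (d + 1) := by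
  have hanti := v_coe_sub_one_apply_add_rev_le_of_even hvσ hσϖ hϖ hres γ hd hd1 hY
  have hdiag := v_coe_sub_one_rev_apply_le_of_even hvσ hσϖ hϖ hres h2 γ hd hd1 hY
  set Y : Matrix (Fin 3) (Fin 3) K := ((γ : GL (Fin 3) K) : Matrix (Fin 3) (Fin 3) K) - 1 with hYdef
  have hr0 : (0 : Fin 3).rev = 2 := rfl
  have hr1 : (1 : Fin 3).rev = 1 := rfl
  have hr2 : (2 : Fin 3).rev = 0 := rfl
  -- the residually vanishing entries: `Y₂₀`, `Y₁₁`, `Y₀₂`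
  have h20 : Valued.v (Y 2 0) ≤ Valued.v ϖ ^ (d + 1) := by have h := hdiag 0; rw [hr0] at h; exact h
  have h11 : Valued.v (Y 1 1) ≤ Valued.v ϖ ^ (d + 1) := by have h := hdiag 1; rw [hr1] at h; exact h
  have h02 : Valued.v (Y 0 2) ≤ Valued.v ϖ ^ (d + 1) := by have h := hdiag 2; rw [hr2] at h; exact h
  -- the antisymmetric pairs
  have ha10 : Valued.v (Y 1 0 + Y 2 1) ≤ Valued.v ϖ ^ (d + 1) := by have h := hanti 1 0; rw [hr0, hr1] at h; exact h
  have ha01 : Valued.v (Y 0 1 + Y 1 2) ≤ Valued.v ϖ ^ (d + 1) := by have h := hanti 0 1; rw [hr0, hr1] at h; exact h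
  have ha22 : Valued.v (Y 2 2 + Y 0 0) ≤ Valued.v ϖ ^ (d + 1) := by have h := hanti 2 2; rw [hr2] at h; exact h
  -- product bounds
  have hsum : Valued.v ϖ ^ (2 * d + 1) = Valued.v ϖ ^ (d + 1) * Valued.v ϖ ^ d := by rw [← pow_add]; congr 1; omega
  have hprod : ∀ {x y : K}, Valued.v x ≤ Valued.v ϖ ^ (d + 1) → Valued.v y ≤ Valued.v ϖ ^ d → Valued.v (x * y) ≤ Valued.v ϖ ^ (2 * d + 1) :=
    fun {x y} hx hy => by rw [map_mul, hsum]; exact mul_le_mul' hx hy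
  have hprod' : ∀ {x y : K}, Valued.v x ≤ Valued.v ϖ ^ d → Valued.v y ≤ Valued.v ϖ ^ (d + 1) → Valued.v (x * y) ≤ Valued.v ϖ ^ (2 * d + 1) :=
    fun {x y} hx hy => by rw [mul_comm]; exact hprod hy hx
  -- the square entries, expanded
  have hsq' : ∀ a c : Fin 3, Valued.v (Y a 0 * Y 0 c + Y a 1 * Y 1 c + Y a 2 * Y 2 c) ≤ Valued.v ϖ ^ (2 * d + 1) := by
    intro a c
    have h := hsq a c
    rwa [Matrix.mul_apply, Fin.sum_univ_three] at h
  -- STEP 1: `|Y₂₁| ≤ |ϖ|^(d+1)` from `(Y²)₂₀ = Y₂₀Y₀₀ + Y₂₁Y₁₀ + Y₂₂Y₂₀`, `Y₁₀ ≡ −Y₂₁`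
  have h21 : Valued.v (Y 2 1) ≤ Valued.v ϖ ^ (d + 1) := by
    refine v_le_succ_of_sq_le hϖ (hY 2 1) ?_
    have ha := ha10
    have e : Y 2 1 * Y 2 1 = Y 2 1 * (Y 1 0 + Y 2 1) + Y 2 0 * Y 0 0 + Y 2 2 * Y 2 0 - (Y 2 0 * Y 0 0 + Y 2 1 * Y 1 0 + Y 2 2 * Y 2 0) := by ring
    rw [e]
    refine (Valuation.map_sub _ _ _).trans (max_le ((Valuation.map_add _ _ _).trans (max_le ((Valuation.map_add _ _ _).trans (max_le ?_ ?_)) ?_)) (hsq' 2 0))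
    · exact hprod' (hY 2 1) ha
    · exact hprod h20 (hY 0 0)
    · exact hprod' (hY 2 2) h20
  -- STEP 2: `|Y₁₂| ≤ |ϖ|^(d+1)` from `(Y²)₀₂ = Y₀₀Y₀₂ + Y₀₁Y₁₂ + Y₀₂Y₂₂`, `Y₀₁ ≡ −Y₁₂`
  have h12 : Valued.v (Y 1 2) ≤ Valued.v ϖ ^ (d + 1) := by
    refine v_le_succ_of_sq_le hϖ (hY 1 2) ?_
    have ha := ha01
    have e : Y 1 2 * Y 1 2 = (Y 0 1 + Y 1 2) * Y 1 2 + Y 0 0 * Y 0 2 + Y 0 2 * Y 2 2 - (Y 0 0 * Y 0 2 + Y 0 1 * Y 1 2 + Y 0 2 * Y 2 2) := by ring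
    rw [e]
    refine (Valuation.map_sub _ _ _).trans (max_le ((Valuation.map_add _ _ _).trans (max_le ((Valuation.map_add _ _ _).trans (max_le ?_ ?_)) ?_)) (hsq' 0 2))
    · exact hprod ha (hY 1 2)
    · exact hprod' (hY 0 0) h02
    · exact hprod h02 (hY 2 2)
  -- the mirrored entries `Y₁₀ ≡ −Y₂₁`, `Y₀₁ ≡ −Y₁₂`
  have h10 : Valued.v (Y 1 0) ≤ Valued.v ϖ ^ (d + 1) := by
    have ha := ha10
    have e : Y 1 0 = (Y 1 0 + Y 2 1) - Y 2 1 := by ring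
    rw [e]; exact (Valuation.map_sub _ _ _).trans (max_le ha h21)
  have h01 : Valued.v (Y 0 1) ≤ Valued.v ϖ ^ (d + 1) := by
    have ha := ha01
    have e : Y 0 1 = (Y 0 1 + Y 1 2) - Y 1 2 := by ring
    rw [e]; exact (Valuation.map_sub _ _ _).trans (max_le ha h12)
  -- STEP 3: `|Y₀₀| ≤ |ϖ|^(d+1)` from `(Y²)₀₀ = Y₀₀² + Y₀₁Y₁₀ + Y₀₂Y₂₀`
  have h00 : Valued.v (Y 0 0) ≤ Valued.v ϖ ^ (d + 1) := by
    refine v_le_succ_of_sq_le hϖ (hY 0 0) ?_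
    have e : Y 0 0 * Y 0 0 = (Y 0 0 * Y 0 0 + Y 0 1 * Y 1 0 + Y 0 2 * Y 2 0) - Y 0 1 * Y 1 0 - Y 0 2 * Y 2 0 := by ring
    rw [e]
    refine (Valuation.map_sub _ _ _).trans (max_le ((Valuation.map_sub _ _ _).trans (max_le (hsq' 0 0) ?_)) ?_)
    · exact hprod h01 (hY 1 0)
    · exact hprod h02 (hY 2 0)
  -- `Y₂₂ ≡ −Y₀₀`
  have h22 : Valued.v (Y 2 2) ≤ Valued.v ϖ ^ (d + 1) := by
    have ha := ha22
    have e : Y 2 2 = (Y 2 2 + Y 0 0) - Y 0 0 := by ring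
    rw [e]; exact (Valuation.map_sub _ _ _).trans (max_le ha h00)
  fin_cases i <;> fin_cases j
  exacts [h00, h01, h02, h10, h11, h12, h20, h21, h22]

/-- **`hodd` IN TOKENS**: at a self-dual vertex `u·L₀` (`u ∈ U(σ, J₀)`) fixed by `γ ∈ U(σ, J₀)` with `LEV (ϖ^d)` and `LEV₂ (ϖ^{2d+1})` for an EVEN `d ≥ 1`, also `LEV (ϖ^{d+1})`:
`(γ−1)·(u·L₀) ⊆ ϖ^d·(u·L₀) ∧ (γ−1)²·(u·L₀) ⊆ ϖ^{2d+1}·(u·L₀) ⇒ (γ−1)·(u·L₀) ⊆ ϖ^{d+1}·(u·L₀)` — rank `≤ 1` never occurs at exact even depth.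
[cite: Tits1979, §3.5] [cite: Kottwitz1986, §3] [cite: BruhatTits1972, §10] -/
theorem map_sub_one_latt_le_scaleLattice_succ_of_even (hvσ : ∀ z, Valued.v (σ z) = Valued.v z) (hσϖ : σ ϖ = -ϖ) (hϖ : Valued.v ϖ = WithZero.exp (-1 : ℤ))
    (hres : ∀ x : K, Valued.v x ≤ 1 → Valued.v (σ x - x) < 1) (h2 : Valued.v (2 : K) = 1)
    (u γ : unitaryGroupOfForm σ ((StdForm.antidiagonal 3).over K)) {d : ℕ} (hd : Even d) (hd1 : 1 ≤ d)
    (hlev : (latt ((u : GL (Fin 3) K) : Matrix (Fin 3) (Fin 3) K)).map ((Matrix.toLin' (((γ : GL (Fin 3) K) : Matrix (Fin 3) (Fin 3) K) - 1)).restrictScalars 𝒪[K]) ≤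
      scaleLattice (ϖ ^ d) (latt ((u : GL (Fin 3) K) : Matrix (Fin 3) (Fin 3) K)))
    (hlev₂ : (latt ((u : GL (Fin 3) K) : Matrix (Fin 3) (Fin 3) K)).map ((Matrix.toLin' ((((γ : GL (Fin 3) K) : Matrix (Fin 3) (Fin 3) K) - 1) ^ 2)).restrictScalars 𝒪[K]) ≤
      scaleLattice (ϖ ^ (2 * d + 1)) (latt ((u : GL (Fin 3) K) : Matrix (Fin 3) (Fin 3) K))) :
    (latt ((u : GL (Fin 3) K) : Matrix (Fin 3) (Fin 3) K)).map ((Matrix.toLin' (((γ : GL (Fin 3) K) : Matrix (Fin 3) (Fin 3) K) - 1)).restrictScalars 𝒪[K]) ≤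
      scaleLattice (ϖ ^ (d + 1)) (latt ((u : GL (Fin 3) K) : Matrix (Fin 3) (Fin 3) K)) := by
  have hϖ0 : ϖ ≠ 0 := fun h0 => by rw [h0, map_zero] at hϖ; exact WithZero.coe_ne_zero hϖ.symm
  have hu : IsUnit ((u : GL (Fin 3) K) : Matrix (Fin 3) (Fin 3) K).det := Matrix.isUnits_det_units _
  -- the conjugate `γ′ = u⁻¹γu ∈ U(σ,J₀)` and its `Y′ = γ′ − 1 = u⁻¹(γ−1)u`
  have hconj : ((u : GL (Fin 3) K) : Matrix (Fin 3) (Fin 3) K)⁻¹ * (((γ : GL (Fin 3) K) : Matrix (Fin 3) (Fin 3) K) - 1) * ((u : GL (Fin 3) K) : Matrix (Fin 3) (Fin 3) K) =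
      (((u⁻¹ * γ * u : unitaryGroupOfForm σ ((StdForm.antidiagonal 3).over K)) : GL (Fin 3) K) : Matrix (Fin 3) (Fin 3) K) - 1 := by
    rw [coe_inv_mul_mul_sub_one, Matrix.coe_units_inv]
  rw [map_toLin'_latt_le_scaleLattice_iff (pow_ne_zero _ hϖ0) _ hu, hconj] at hlev ⊢
  rw [map_toLin'_latt_le_scaleLattice_iff (pow_ne_zero _ hϖ0) _ hu, inv_mul_sq_mul_eq_sq _ hu, hconj] at hlev₂
  intro i k
  rw [map_pow]
  refine forall_v_coe_sub_one_le_succ_of_even_of_sq_le hvσ hσϖ hϖ hres h2 (u⁻¹ * γ * u) hd hd1 (fun i j => by rw [← map_pow]; exact hlev i j)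
    (fun i j => by rw [← pow_two, ← map_pow]; exact hlev₂ i j) i k

end Literature.NumberTheory.Automorphic.UnitaryLatticeTree

end
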